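import Literature.AlgebraicTopology.SingularHomology.LocalHomologyVanishing
import Literature.AlgebraicTopology.SingularHomology.FundamentalClassExistence
import HarnessLib

/-!
# The push-forward of a fundamental class along a map which is a homeomorphism near a point
with a one-point fibre does not vanish

Helper file (pure topology) for the support item `CurveNetExists` of route
`Summits/HodgeConjecture/HodgeConjecture/Theses/CurveNetMordellWeil`: the blow-down
`σ : X̃ → X` of a curve net is an isomorphism over the dense open `X ∖ F`, and the cohomological
transfer `σ_* σ^* = (unit) • id` needs `σ(ℂ)_* [X̃(ℂ)] ≠ 0` in `H_{2n}(X(ℂ); ℂ)` — the topological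
degree of the birational `σ(ℂ)` is not zero. This is the following elementary statement about
fundamental classes (Hatcher, *Algebraic Topology*, §3.3, Thm. 3.26 and Lemma 3.27, local degree
as in §2.2 Prop. 2.30), PROVED here for every coefficient ring from the tree's local homology
calculus (`Orientation`, `LocalHomologyVanishing`, `FundamentalClassExistence`):

* `isIso_relativeMap_of_homeomorph_nhds` — if `f : A → B` restricts to a homeomorphism `V ≃ₜ W`
  between open neighbourhoods of `x` and `f x` and `f⁻¹(f x) = {x}`, then `f` induces an
  isomorphism `Hₖ(A | x) ≅ Hₖ(B | f x)` on local homology (excision to `V` and `W`, Hatcher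
  Thm. 2.20, `localHomology.isIso_map_subsetIncl_of_isOpen`, and the homeomorphism);
* `map_fundamentalClass_ne_zero_of_homeomorph_nhds` — for a closed `R`-oriented manifold `A`
  (`R` non-trivial) and such an `f`, `f_* [A]_μ ≠ 0` in `H_d(B; R)`: its image in `H_d(B | f x)` is
  the image of the generator `μₓ` (`[A]_μ` restricts to `μₓ`, Hatcher Thm. 3.26(a), the tree's
  `isFundamentalClass_fundamentalClass_holds`) under that isomorphism.

## References

* [HatcherAT2002] A. Hatcher, Algebraic Topology, CUP 2002, §2.1 Thm. 2.20, §2.2 Prop. 2.30,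
  §3.3 Thm. 3.26.
-/

noncomputable section

open CategoryTheory Set Topology
open Literature.AlgebraicTopology.SingularHomology

universe u v

-- `Summit.HodgeConjecture.HodgeConjecture.Theorems` is the mandated namespace (single-conjunct summit:
-- Sub = Summit), which `linter.dupNamespace` flags on every declaration; the lakefile turns the
-- linter off tree-wide (weak option), restated here so stand-alone elaboration is warning-free too.
set_option linter.dupNamespace false

namespace Summit.HodgeConjecture.HodgeConjecture.Theorems

variable (R : Type v) [CommRing R] (M : Type v) [AddCommGroup M] [Module R M]
variable {A B : Type u} [TopologicalSpace A] [TopologicalSpace B]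

/-- A morphism of `R`-modules which is an isomorphism is injective. [folklore] -/
theorem injective_of_isIso_moduleCat {P Q : ModuleCat.{u} R} (φ : P ⟶ Q) [IsIso φ] :
    Function.Injective φ :=
  ((ConcreteCategory.isIso_iff_bijective φ).1 inferInstance).1

/-- **A map which is a homeomorphism near `x` with `f⁻¹(f x) = {x}` induces an isomorphism
`Hₖ(A | x; M) ≅ Hₖ(B | f x; M)` on local homology**: if `f` agrees on the open neighbourhood `V`
of `x` with a homeomorphism `e : V ≃ₜ W` onto an open `W ⊆ B`, and `f` maps `A ∖ {x}` into
`B ∖ {f x}`, then `f_* : Hₖ(A, A ∖ x) → Hₖ(B, B ∖ f x)` is an isomorphism — it is conjugate, through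
the excision isomorphisms `Hₖ(V | x) ≅ Hₖ(A | x)` and `Hₖ(W | f x) ≅ Hₖ(B | f x)` (Hatcher
Thm. 2.20), to the isomorphism induced by `e` (Hatcher §3.3 p. 231: local homology depends only
on a neighbourhood; §2.2 Prop. 2.30 for the local degree of a local homeomorphism).
[cite: HatcherAT2002, Thm. 2.20 and §3.3 p. 231] -/
theorem isIso_relativeMap_of_homeomorph_nhds [T1Space A] [T1Space B] (f : C(A, B)) {V : Set A}
    {W : Set B} (hV : IsOpen V) (hW : IsOpen W) (e : V ≃ₜ W) (he : ∀ v : V, ((e v : W) : B) = f v)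
    {x : A} (hx : x ∈ V) (hf : Set.MapsTo f ({x}ᶜ : Set A) ({f x}ᶜ : Set B)) (k : ℕ) :
    IsIso (relativeSingularHomology.map R M f hf k) := by
  have hy : f x ∈ W := by
    rw [← he ⟨x, hx⟩]
    exact (e ⟨x, hx⟩).2
  have hex : e ⟨x, hx⟩ = ⟨f x, hy⟩ := Subtype.ext (he ⟨x, hx⟩)
  have h1 : Set.MapsTo (e : C(V, W)) ({(⟨x, hx⟩ : V)}ᶜ : Set V) ({(⟨f x, hy⟩ : W)}ᶜ : Set W) := by
    intro v hv h
    apply hv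
    rw [Set.mem_singleton_iff] at h ⊢
    apply e.injective
    rw [hex]
    exact h
  have h2 : Set.MapsTo (e.symm : C(W, V)) ({(⟨f x, hy⟩ : W)}ᶜ : Set W)
      ({(⟨x, hx⟩ : V)}ᶜ : Set V) := by
    intro w hw h
    apply hw
    rw [Set.mem_singleton_iff] at h ⊢
    have h' : e.symm w = ⟨x, hx⟩ := h
    rw [← e.apply_symm_apply w, h', hex]
  haveI : IsIso (relativeSingularHomology.map R M (e : C(V, W)) h1 k) := by
    refine ⟨relativeSingularHomology.map R M (e.symm : C(W, V)) h2 k, ?_, ?_⟩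
    · rw [← relativeSingularHomology.map_comp, ← relativeSingularHomology.map_id]
      congr 1
      ext v
      simp
    · rw [← relativeSingularHomology.map_comp, ← relativeSingularHomology.map_id]
      congr 1
      ext w
      simp
  haveI := localHomology.isIso_map_subsetIncl_of_isOpen R M hV hx k
  haveI := localHomology.isIso_map_subsetIncl_of_isOpen R M hW hy k
  have hsq : relativeSingularHomology.map R M (subsetIncl V)
        (localHomology.mapsTo_subsetIncl_compl hx) k ≫ relativeSingularHomology.map R M f hf k =
      relativeSingularHomology.map R M (e : C(V, W)) h1 k ≫
        relativeSingularHomology.map R M (subsetIncl W)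
          (localHomology.mapsTo_subsetIncl_compl hy) k := by
    rw [← relativeSingularHomology.map_comp, ← relativeSingularHomology.map_comp]
    congr 1
    ext v
    exact (he v).symm
  have hfac : relativeSingularHomology.map R M f hf k =
      inv (relativeSingularHomology.map R M (subsetIncl V)
        (localHomology.mapsTo_subsetIncl_compl hx) k) ≫
        (relativeSingularHomology.map R M (e : C(V, W)) h1 k ≫
          relativeSingularHomology.map R M (subsetIncl W)
            (localHomology.mapsTo_subsetIncl_compl hy) k) := by
    rw [← hsq, IsIso.inv_hom_id_assoc]
  rw [hfac]
  infer_instance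

/-- **The push-forward of the fundamental class along a map which is a homeomorphism near a
point with a one-point fibre is non-zero.** Let `A` be a closed `R`-oriented topological
`d`-manifold (`R` non-trivial), `f : A → B` continuous (`B` a `T₁` space), and suppose `f` agrees
on an open neighbourhood `V` of `x` with a homeomorphism onto an open subset `W ⊆ B` and
`f⁻¹(f x) = {x}`. Then `f_* [A]_μ ≠ 0` in `H_d(B; R)`: by naturality of `Hₙ(–) → Hₙ(– | ·)`, the image
of `f_* [A]_μ` in `H_d(B | f x)` is `f_*` of the restriction `μₓ` of `[A]_μ` (Hatcher Thm. 3.26(a),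
the tree's `isFundamentalClass_fundamentalClass_holds`), a generator, and `f_*` is an isomorphism
on local homology (`isIso_relativeMap_of_homeomorph_nhds`). This is "`deg f = Σ local degrees`"
(Hatcher Prop. 2.30) in the case of a single preimage point. [cite: HatcherAT2002, §3.3 Thm. 3.26(a) and §2.2 Prop. 2.30] -/
theorem map_fundamentalClass_ne_zero_of_homeomorph_nhds [Nontrivial R] [CompactSpace A] [T2Space A]
    {d : ℕ} [ChartedSpace (EuclideanSpace ℝ (Fin d)) A] [T1Space B] (μ : HomologicalOrientation R A d)
    (f : C(A, B)) {V : Set A} {W : Set B} (hV : IsOpen V) (hW : IsOpen W) (e : V ≃ₜ W)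
    (he : ∀ v : V, ((e v : W) : B) = f v) {x : A} (hx : x ∈ V)
    (hf : Set.MapsTo f ({x}ᶜ : Set A) ({f x}ᶜ : Set B)) :
    singularHomology.map R R f d μ.fundamentalClass ≠ 0 := by
  intro h0
  haveI := isIso_relativeMap_of_homeomorph_nhds R R f hV hW e he hx hf d
  have hfc := HomologicalOrientation.isFundamentalClass_fundamentalClass_holds (R := R) (X := A) d μ x
  have hnat := relativeSingularHomology.ofAbsolute_comp_map R R f hf d
  have key : relativeSingularHomology.map R R f hf d (μ.localClass x) = 0 := by
    rw [← hfc, singularHomology.toLocal_eq_toLocalOfSet, singularHomology.toLocalOfSet,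
      ← ModuleCat.comp_apply, hnat, ModuleCat.comp_apply, h0, map_zero]
  obtain ⟨ε, hε⟩ := μ.isGenerator x
  have hzero : μ.localClass x = 0 :=
    injective_of_isIso_moduleCat R (relativeSingularHomology.map R R f hf d) (by rw [key, map_zero])
  exact one_ne_zero (α := R) (by rw [← hε, hzero, map_zero])

end Summit.HodgeConjecture.HodgeConjecture.Theorems

end
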